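import Literature.NumberTheory.GaloisRepresentations.EulerSystem
import HarnessLib

/-!
# The relative corestriction on continuous `H¹` is `G`-equivariant:
# `cor_{H′/H} ∘ (g·) = (g·) ∘ cor_{H′/H}` for `H ≤ H′` both normal in `G`

Topic `NumberTheory/GaloisRepresentations`; namespace `Literature.NumberTheory.GaloisRepresentations`.
Complement to `ContinuousCorestriction.lean` (the relative corestriction `coresLe` and the action
`conjMap`), `EulerSystem.lean` §"Inner automorphisms act trivially" and `ContinuousCorestrictionConj.lean`
(which treats the ABSOLUTE corestriction `cores : H¹(N, X) → H¹(G, X)`, invariant under `conjMap`).  Seat `bsd-potss-rkm` (prover, cell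
`bsd-potss`, item stmt-BirchSwinnertonDyer-19196): the equivariance is the input making the trace maps
`Cor : H¹(ℚ_{n+1}, T) → H¹(ℚ_n, T)` of Kato §12.2 commute with the `Γ`-action, i.e. `Λ`-linear
(`Kato2004/IwasawaCohomologyExistsProofs.lean`, discharge of `Kato2004.nonempty_iwasawaH1Data`).

PROVENANCE: statements and proofs are RE-HOMED VERBATIM from the Summits tool file
`Summits/BirchSwinnertonDyer/Rank1Residual/GaloisImage/ContinuousCorestrictionGalois.lean`
(cell `b2b-bsdres`, team n1011, decls `…GaloisImage.Derivative.Mackey.{leftRel_subgroupConj,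
subgroupConj_subgroupConj_inv, subgroupConj_inv_subgroupConj, coresLe_conjMap}`), which a Literature
file cannot import (CONVENTIONS §2).  PROOFS only (the two power lemmas are new, elementary); no definition, no named fact, no `instance`.

* `conjMap_toLinearMap_pow_apply`, `conjMap_toLinearMap_pow_eq_one` — powers of the operator `g·`
  on `H¹(H, X)` are the operators `g^k·` (`conjMap_mul_apply_one`), hence `(g·)^m = 1` as soon as
  `g^m ∈ H` (inner automorphisms act trivially, `conjMap_one_apply_of_mem` of `EulerSystem.lean`) —
  e.g. `conj_γ^{p^n} = 1` on `H¹(ℚ_n, T)` for a topological generator `γ` of a `ℤ_p`-extension.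
* `coresLe_conjMap` — for `H ≤ H′` both normal in `G`, `H` open of finite index in `H′`, `g ∈ G`:
  `coresLe X h hH (conjMap X H g 1 y) = conjMap X H′ g 1 (coresLe X h hH y)`.  On cocycles: the
  transfer of `g·φ` computed with representatives `s` of `H′/H` equals `g·` the transfer of `φ`
  computed with the conjugated representatives `c ↦ g⁻¹ s(g c g⁻¹) g`.

## References

* J. Neukirch, A. Schmidt, K. Wingberg, *Cohomology of Number Fields*, 2nd ed. (2008), I §5
  Prop. 1.5.4 (`cor` commutes with conjugation `σ_*`). [NeukirchSchmidtWingberg2008]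
* J.-P. Serre, *Local Fields* (1979), VII §5–§7. [SerreLocalFields1979]
-/

noncomputable section

open CategoryTheory Function Finset

universe u v

namespace Literature.NumberTheory.GaloisRepresentations

open Literature.NumberTheory.EllipticCurves (schreierElt schreierElt_mem schreierElt_coe
  subgroupInclusion subgroupInclusion_apply_coe subgroupConj subgroupConj_apply_coe
  conj_mem_of_normal)

variable {R : Type u} [Ring R] [TopologicalSpace R]
variable {G : Type v} [Group G] [TopologicalSpace G] [IsTopologicalGroup G]

section Powers

variable (X : TopRep.{v} R G)

/-- Powers of the operator `g·` on `H¹(H, X)` are the operators `g^k ·`: `conjMap` is an action of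
`G` (through `G/H`) on `H¹(H, X)` (Serre, *Local Fields* VII §5: "`G/H` acts on `H^q(H, A)`";
`conjMap_mul_apply_one`). [cite: SerreLocalFields1979, VII §5 Prop. 3]
[cite: NeukirchSchmidtWingberg2008, I §5 (1.5.4) and (1.6.3)] -/
theorem conjMap_toLinearMap_pow_apply (H : Subgroup G) [H.Normal] (g : G) (k : ℕ)
    (c : continuousCohomology 1 (subgroupRep X H)) :
    ((conjMap X H g 1).hom.toLinearMap ^ k) c = conjMap X H (g ^ k) 1 c := by
  induction k generalizing c with
  | zero =>
    rw [pow_zero, pow_zero, Module.End.one_apply]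
    exact (conjMap_one_apply_of_mem X H (1 : H) c).symm
  | succ k ih =>
    rw [pow_succ, Module.End.mul_apply, pow_succ, conjMap_mul_apply_one]
    exact ih _

/-- If `g^m ∈ H`, the operator `g·` on `H¹(H, X)` satisfies `(g·)^m = 1`: the action of `G` on
`H¹(H, X)` factors through `G/H` (inner automorphisms act trivially, Serre *Local Fields* VII §5
Prop. 3; `conjMap_one_apply_of_mem`). [cite: SerreLocalFields1979, VII §5 Prop. 3]
[cite: NeukirchSchmidtWingberg2008, I §5 (1.6.3)] -/
theorem conjMap_toLinearMap_pow_eq_one (H : Subgroup G) [H.Normal] {g : G} {m : ℕ}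
    (hg : g ^ m ∈ H) : (conjMap X H g 1).hom.toLinearMap ^ m = 1 := by
  refine LinearMap.ext fun c ↦ ?_
  rw [conjMap_toLinearMap_pow_apply, Module.End.one_apply]
  exact conjMap_one_apply_of_mem X H ⟨g ^ m, hg⟩ c

end Powers

section Galois

variable (X : TopRep.{v} R G) {H H' : Subgroup G} [H.Normal] [H'.Normal] (h : H ≤ H')

/-- Conjugation `a ↦ σ⁻¹ a σ` of `H′` respects the cosets of `H ∩ H′` (`H` normal).
(Re-homed verbatim from `Summits/BirchSwinnertonDyer/Rank1Residual/GaloisImage/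
ContinuousCorestrictionGalois.lean`, cell `b2b-bsdres`.) [folklore] -/
private theorem leftRel_subgroupConj (σ : G) (a b : H')
    (hab : QuotientGroup.leftRel (H.subgroupOf H') a b) :
    QuotientGroup.leftRel (H.subgroupOf H') (subgroupConj H' σ a) (subgroupConj H' σ b) := by
  rw [QuotientGroup.leftRel_apply, Subgroup.mem_subgroupOf] at hab ⊢
  rw [← map_inv, ← map_mul, subgroupConj_apply_coe]
  exact conj_mem_of_normal H σ ⟨_, hab⟩

/-- `σ⁻¹ (σ a σ⁻¹) σ = a` on `H′`. [folklore] -/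
private theorem subgroupConj_subgroupConj_inv (σ : G) (a : H') :
    subgroupConj H' σ (subgroupConj H' σ⁻¹ a) = a :=
  Subtype.ext (by simp only [subgroupConj_apply_coe, inv_inv]; group)

/-- `σ (σ⁻¹ a σ) σ⁻¹ = a` on `H′`. [folklore] -/
private theorem subgroupConj_inv_subgroupConj (σ : G) (a : H') :
    subgroupConj H' σ⁻¹ (subgroupConj H' σ a) = a :=
  Subtype.ext (by simp only [subgroupConj_apply_coe, inv_inv]; group)

/-- **`cor_{H′/H}` is `G`-equivariant**: for `H ≤ H′` both normal in `G`, `H` open of finite index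
in `H′`, and `g ∈ G`, `coresLe X h hH (g · y) = g · coresLe X h hH y` on `H¹(H, X)` (on cocycles the
transfer of `g·φ` for representatives `s` is `g·` the transfer of `φ` for the conjugated
representatives `c ↦ g⁻¹ s(g c g⁻¹) g`; NSW (2008) Prop. 1.5.4).  Re-homed verbatim from
`Summits/BirchSwinnertonDyer/Rank1Residual/GaloisImage/ContinuousCorestrictionGalois.lean`
(`…GaloisImage.Derivative.Mackey.coresLe_conjMap`, cell `b2b-bsdres`), which Literature cannot import.
[cite: NeukirchSchmidtWingberg2008, I §5 Prop. 1.5.4] -/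
theorem coresLe_conjMap (hH : IsOpen (H : Set G)) [Fintype (H' ⧸ H.subgroupOf H')] (g : G)
    (y : continuousCohomology 1 (subgroupRep X H)) :
    coresLe X h hH (conjMap X H g 1 y) = conjMap X H' g 1 (coresLe X h hH y) := by
  classical
  obtain ⟨φ, rfl⟩ := oneCocycleClass_surjective _ y
  -- conjugation by `g` on `H′ ⧸ (H ∩ H′)` and its inverse
  let β : H' ⧸ H.subgroupOf H' → H' ⧸ H.subgroupOf H' :=
    Quotient.map' (subgroupConj H' g⁻¹) (leftRel_subgroupConj g⁻¹)
  let β' : H' ⧸ H.subgroupOf H' → H' ⧸ H.subgroupOf H' :=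
    Quotient.map' (subgroupConj H' g) (leftRel_subgroupConj g)
  have hβ : ∀ a : H', β (a : H' ⧸ H.subgroupOf H') =
      ((subgroupConj H' g⁻¹ a : H') : H' ⧸ H.subgroupOf H') := fun _ => rfl
  have hβ' : ∀ a : H', β' (a : H' ⧸ H.subgroupOf H') =
      ((subgroupConj H' g a : H') : H' ⧸ H.subgroupOf H') := fun _ => rfl
  have hββ' : ∀ c, β (β' c) = c := fun c => by
    induction c using QuotientGroup.induction_on with
    | H a => rw [hβ', hβ, subgroupConj_inv_subgroupConj]
  have hβ'β : ∀ c, β' (β c) = c := fun c => by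
    induction c using QuotientGroup.induction_on with
    | H a => rw [hβ, hβ', subgroupConj_subgroupConj_inv]
  let eβ : H' ⧸ H.subgroupOf H' ≃ H' ⧸ H.subgroupOf H' := ⟨β, β', hβ'β, hββ'⟩
  -- twisted equivariance `β ((g⁻¹ x g) • c) = x • β c`
  have hβsmul : ∀ (x : H') (c : H' ⧸ H.subgroupOf H'),
      β (subgroupConj H' g x • c) = x • β c := fun x c => by
    induction c using QuotientGroup.induction_on with
    | H a =>
      rw [MulAction.Quotient.smul_coe, smul_eq_mul, hβ, hβ, MulAction.Quotient.smul_coe,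
        smul_eq_mul, map_mul, subgroupConj_inv_subgroupConj]
  -- representatives `s` and the conjugated representatives `s′`
  set s : H' ⧸ H.subgroupOf H' → H' := Quotient.out with hs_def
  have hs : ∀ c, (s c : H' ⧸ H.subgroupOf H') = c := QuotientGroup.out_eq'
  set s' : H' ⧸ H.subgroupOf H' → H' := fun c => subgroupConj H' g (s (β c)) with hs'_def
  have hs'c : ∀ c, s' c = subgroupConj H' g (s (β c)) := fun _ => rfl
  have hs' : ∀ c, (s' c : H' ⧸ H.subgroupOf H') = c := fun c => by
    rw [hs'c, ← hβ', hs, hβ'β]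
  rw [conjMap_oneCocycleClass, coresLe_oneCocycleClass X h hH hs,
    coresLe_oneCocycleClass X h hH hs', conjMap_oneCocycleClass]
  refine congrArg _ (Subtype.ext (ContinuousMap.ext fun x => ?_))
  rw [transferCocycle_apply, transferFun_apply, conj_pullback_apply, transferCocycle_apply,
    transferFun_apply, map_sum]
  conv_lhs => rw [← eβ.sum_comp]
  refine Finset.sum_congr rfl fun c _ => ?_
  have heβ : (eβ c : H' ⧸ H.subgroupOf H') = β c := rfl
  rw [heβ, hs'c, hβsmul]
  change X.ρ ((s (x • β c) : H') : G) (X.ρ g (φ.1 (subgroupConj H g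
      (subgroupOfHom h (schreierElt (H.subgroupOf H') hs x (β c)))))) =
    X.ρ g (X.ρ ((subgroupConj H' g (s (x • β c)) : H') : G)
      (φ.1 (subgroupOfHom h (schreierElt (H.subgroupOf H') hs' (subgroupConj H' g x) c))))
  rw [← ρ_mul_apply X g, subgroupConj_apply_coe,
    show g * (g⁻¹ * ((s (x • β c) : H') : G) * g) = ((s (x • β c) : H') : G) * g by group,
    ρ_mul_apply]
  congr 3
  apply Subtype.ext
  simp only [subgroupConj_apply_coe, subgroupOfHom_apply_coe, schreierElt_coe, hs'c, hβsmul,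
    Subgroup.coe_mul, Subgroup.coe_inv]
  group

end Galois

end Literature.NumberTheory.GaloisRepresentations

end
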